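import Summits.Ventures.PercRepro.RankLevelSetDepCountGen
import Summits.Ventures.PercRepro.RankLevelSetLevelSixArithE
import Summits.Ventures.PercRepro.RankLevelSetLevelFive
import Summits.Ventures.PercRepro.RankLevelSetPlaneTen
import Summits.Ventures.PercRepro.RankLevelSetCoreFour
import Summits.Ventures.PercRepro.RankLevelSetFrameLarge
import Summits.Ventures.PercRepro.RankLevelSetFrameQM

/-!
# PercRepro — THEOREM C₆: C-025 AT LEVEL `6` FOR EVERY FINITE MATROID AND EVERY `p ≥ 124426`, GIVEN LEVEL `5`
(night-1, gen 4)

`proofs/NIGHT-1-C025-induction.md` §15.9. The level-`5` recipe (`RankLevelSetLevelFive`) one level up: the wrapper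
`rls_succ_large 5 6 124425` needs level `6` only at corank `≤ 6` outside the core (`U = ∅` / Theorem M) and on the
`e`-free core at every corank `≥ 7`: coranks `≥ 51` are `c025_core_six_fortythree` (`RankLevelSetCoreFour`, `p ≥ 81`),
coranks `7 … 50` are `c025_core_six_bounded_corank` — the general count `ncard_eRk_eq_ncard_le_le` at `q = 6` with the
flat bound `f(6) ≤ 43` (`ncard_le_fortythree_of_eRk_le_six_of_free`), the circuit counts `s_k ≤ C(d + k − 1, k)`
(`k = 3 … 7`), the tail `16·Σ_{j ≤ 50} C(n, j) ≤ 2^n`, and the 44 polynomial inequalities `level_six_poly`.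

* **`c025_six_of_five`** — level `5` for all `p ≥ 835` implies level `6` for every finite matroid and every
  `p ≥ 124426`;
* **`c025_six_of_three`** — the same from level `3` for all `p ≥ 5` (through THEOREMS C₄ and C₅).
Axioms: standard.
-/

open scoped Matroid

namespace PercRepro

namespace ThmN

open Set

variable {α : Type}

/-- The level-`6` count in the five-term form: `Σ_{k ∈ [3, 7]} g k = g 3 + g 4 + g 5 + g 6 + g 7`. -/
theorem sum_Icc_three_seven (g : ℕ → ℕ) : ∑ k ∈ Finset.Icc 3 7, g k = g 3 + g 4 + g 5 + g 6 + g 7 := by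
  rw [show (7 : ℕ) = 6 + 1 from rfl, Finset.sum_Icc_succ_top (by norm_num), sum_Icc_three_six]

/-- **The `e`-free core at level `6`, corank `7 ≤ d ≤ 50`, rank `p ≥ 124425`.** -/
theorem c025_core_six_bounded_corank (M : Matroid α) [M.Finite] (p d : ℕ) (hp : 124425 ≤ p) (hd7 : 7 ≤ d)
    (hd50 : d ≤ 50) (hR : M.eRank = (p : ℕ∞)) (hn : M.E.ncard = p + d)
    (hfree : ∀ e ∈ M.E, ∃ A ⊆ M.E \ {e}, e ∉ M.closure A ∧ e ∉ M.closure ((M.E \ {e}) \ A)) :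
    RLS M p 6 := by
  classical
  have hEcard : M.ground_finite.toFinset.card = p + d := by
    rw [← Set.ncard_eq_toFinset_card _ M.ground_finite]; exact hn
  -- the core is simple: every circuit has `≥ 3` elements
  have hL : ∀ e ∈ M.E, ¬ M.IsLoop e := not_isLoop_of_free M hfree
  have hs : ∀ e ∈ M.E, ∀ f ∈ M.E, e ≠ f → M.eRk {e, f} = 2 := by
    intro e he f hf hef
    have h2 : (2 : ℕ∞) ≤ M.eRk {e, f} :=
      two_le_eRk_of_two_le_ncard_of_free M hfree (pair_subset he hf) (by rw [ncard_pair hef])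
    have h3 : M.eRk {e, f} ≤ 2 := by
      have := M.eRk_le_encard {e, f}
      rwa [encard_pair hef] at this
    exact le_antisymm h3 h2
  have hcirc : ∀ C, M.IsCircuit C → 3 ≤ C.encard := three_le_encard_of_circuit M hL hs
  -- rank-`≤ 6` sets have `≤ 43` points
  have hflat : ∀ X ⊆ M.E, M.eRk X ≤ 6 → X.ncard ≤ 43 :=
    fun X hX hr => ncard_le_fortythree_of_eRk_le_six_of_free M hfree hX hr
  have hd : M.E.encard = M.eRank + d := by
    rw [hR, ← M.ground_finite.cast_ncard_eq, hn]
    push_cast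
    ring
  -- (U)
  have hU1 := Matroid.topCount_le_ncard_compl (M := M) hR hd 6
  have hU2 := Matroid.ncard_eRk_eq_ncard_le_le M 6 43 hcirc hflat d
  rw [hn, sum_Icc_three_seven] at hU2
  simp only [show (6 : ℕ) + 1 - 3 = 4 from rfl, show (6 : ℕ) + 1 - 4 = 3 from rfl,
    show (6 : ℕ) + 1 - 5 = 2 from rfl, show (6 : ℕ) + 1 - 6 = 1 from rfl,
    show (6 : ℕ) + 1 - 7 = 0 from rfl, Nat.choose_one_right,
    Nat.choose_zero_right, mul_one, show (43 : ℕ) - (6 + 1) = 36 from rfl,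
    show (6 : ℕ) + 1 = 7 from rfl] at hU2
  have hs3 : {C | M.IsCircuit C ∧ C.ncard = 3}.ncard ≤ (d + 2).choose 3 :=
    Matroid.ncard_circuits_le_choose_of_encard M hd 2
  have hs4 : {C | M.IsCircuit C ∧ C.ncard = 4}.ncard ≤ (d + 3).choose 4 :=
    Matroid.ncard_circuits_le_choose_of_encard M hd 3
  have hs5 : {C | M.IsCircuit C ∧ C.ncard = 5}.ncard ≤ (d + 4).choose 5 :=
    Matroid.ncard_circuits_le_choose_of_encard M hd 4
  have hs6 : {C | M.IsCircuit C ∧ C.ncard = 6}.ncard ≤ (d + 5).choose 6 :=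
    Matroid.ncard_circuits_le_choose_of_encard M hd 5
  have hs7 : {C | M.IsCircuit C ∧ C.ncard = 7}.ncard ≤ (d + 6).choose 7 :=
    Matroid.ncard_circuits_le_choose_of_encard M hd 6
  have hU : Matroid.topCount M p 6 ≤ (p + d).choose 6 +
      (∑ j ∈ Finset.range (d - 7 + 1), Nat.choose 36 j) *
        ((d + 2).choose 3 * (p + d).choose 4 + (d + 3).choose 4 * (p + d).choose 3 +
          (d + 4).choose 5 * (p + d).choose 2 + (d + 5).choose 6 * (p + d) + (d + 6).choose 7) := by
    refine hU1.trans (hU2.trans ?_)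
    gcongr
  -- (Y)
  have hY := Matroid.two_pow_le_midCount_add (M := M) p 6 hR
  have hA : {X : Set α | X ⊆ M.E ∧ M.eRk X ≤ 6}.ncard ≤ ∑ j ∈ Finset.range (43 + 1), (p + d).choose j := by
    calc {X : Set α | X ⊆ M.E ∧ M.eRk X ≤ 6}.ncard
        ≤ {X : Set α | X ⊆ (M.ground_finite.toFinset : Set α) ∧ X.ncard ≤ 43}.ncard := by
          apply ncard_le_ncard
          · intro X hX
            exact ⟨by rw [Set.Finite.coe_toFinset]; exact hX.1, hflat X hX.1 hX.2⟩
          · exact (Finset.finite_toSet _).finite_subsets.subset (fun X hX => hX.1)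
      _ ≤ ∑ j ∈ Finset.range (43 + 1), M.ground_finite.toFinset.card.choose j :=
          ncard_subsets_ncard_le _ 43
      _ = ∑ j ∈ Finset.range (43 + 1), (p + d).choose j := by rw [hEcard]
  have hB := Matroid.ncard_spanning_le (M := M) hd
  rw [hEcard] at hY hB
  -- the tails
  have hT : 16 * ∑ j ∈ Finset.range 51, (p + d).choose j ≤ 2 ^ (p + d) :=
    sixteen_mul_sum_choose_le_fifty (p + d) (by omega)
  have hA' : ∑ j ∈ Finset.range (43 + 1), (p + d).choose j ≤ ∑ j ∈ Finset.range 51, (p + d).choose j :=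
    Finset.sum_le_sum_of_subset_of_nonneg (Finset.range_mono (by norm_num)) (fun _ _ _ => Nat.zero_le _)
  have hB' : ∑ j ∈ Finset.range (d + 1), (p + d).choose j ≤ ∑ j ∈ Finset.range 51, (p + d).choose j :=
    Finset.sum_le_sum_of_subset_of_nonneg (Finset.range_mono (by omega)) (fun _ _ _ => Nat.zero_le _)
  have hAB : 8 * ({X : Set α | X ⊆ M.E ∧ M.eRk X ≤ 6}.ncard +
      {X : Set α | X ⊆ M.E ∧ M.eRk X = M.eRank}.ncard) ≤ 2 ^ (p + d) := by
    have h1 := hA.trans hA'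
    have h2 := hB.trans hB'
    omega
  -- (Φ) and the polynomial inequality
  have hΦ := phiK_le_two_pow_div p 6
  rw [Nat.choose_symm_add] at hΦ
  have hpoly := level_six_poly d hd7 hd50 p hp
  -- assemble in `ℚ`
  rw [RLS_iff]
  have hUq : (Matroid.topCount M p 6 : ℚ) ≤ ((p + d).choose 6 : ℚ) +
      (((∑ j ∈ Finset.range (d - 7 + 1), Nat.choose 36 j) *
        ((d + 2).choose 3 * (p + d).choose 4 + (d + 3).choose 4 * (p + d).choose 3 +
          (d + 4).choose 5 * (p + d).choose 2 + (d + 5).choose 6 * (p + d) + (d + 6).choose 7) : ℕ) : ℚ) := by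
    exact_mod_cast hU
  have hYq : (2 : ℚ) ^ (p + d) ≤ (Matroid.midCount M p 6 : ℚ) +
      ({X : Set α | X ⊆ M.E ∧ M.eRk X ≤ 6}.ncard : ℚ) +
      ({X : Set α | X ⊆ M.E ∧ M.eRk X = M.eRank}.ncard : ℚ) := by exact_mod_cast hY
  have hABq : 8 * (({X : Set α | X ⊆ M.E ∧ M.eRk X ≤ 6}.ncard : ℚ) +
      ({X : Set α | X ⊆ M.E ∧ M.eRk X = M.eRank}.ncard : ℚ)) ≤ 2 ^ (p + d) := by exact_mod_cast hAB
  have hpolyq : 8 * (((p + d).choose 6 : ℚ) +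
      (((∑ j ∈ Finset.range (d - 7 + 1), Nat.choose 36 j) *
        ((d + 2).choose 3 * (p + d).choose 4 + (d + 3).choose 4 * (p + d).choose 3 +
          (d + 4).choose 5 * (p + d).choose 2 + (d + 5).choose 6 * (p + d) + (d + 6).choose 7) : ℕ) : ℚ)) ≤
      7 * 2 ^ (d - 6) * ((p + 6).choose 6 : ℚ) := by exact_mod_cast hpoly
  have hU0 : (0 : ℚ) ≤ (Matroid.topCount M p 6 : ℚ) := Nat.cast_nonneg _
  have hd6 : 6 ≤ d := by omega
  exact level_arith (p := p) (d := d) (n := p + d) (q := 6) rfl hd6 hΦ hU0 hUq hYq hABq hpolyq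

/-- **THEOREM C₆, GIVEN LEVEL `5`**: if every finite matroid satisfies C-025 at level `5` for all `p ≥ 835`, then every
finite matroid satisfies C-025 at level `6` for all `p ≥ 124426`. -/
theorem c025_six_of_five (h5 : ∀ (M : Matroid α) [M.Finite] (p : ℕ), 835 ≤ p → RLS M p 5) :
    ∀ (M : Matroid α) [M.Finite] (p : ℕ), 124426 ≤ p → RLS M p 6 := by
  intro M _ p hp
  refine rls_succ_large (α := α) 5 6 124425 ?_ ?_ ?_ M p hp (by omega)
  · -- level `5` for `p ≥ 124425`
    intro M' _ p' hP _
    exact h5 M' p' (by omega)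
  · -- corank `≤ 6`: `U = ∅` or Theorem M
    intro M' _ p' _ hn _
    rcases Nat.lt_or_ge M'.E.ncard (p' + 6) with h | h
    · exact RLS_of_ncard_lt M' h
    · exact RLS_of_ncard_eq M' (by omega)
  · -- the core: coranks `7 … 50` by counting, coranks `≥ 51` by `c025_core_six_fortythree`
    intro M' _ p' hP hR hbig _ hfree
    rcases Nat.lt_or_ge M'.E.ncard (p' + 51) with h | h
    · exact c025_core_six_bounded_corank M' p' (M'.E.ncard - p') hP (by omega) (by omega) hR (by omega) hfree
    · exact c025_core_six_fortythree M' p' (by omega) hR (by omega) hfree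

/-- **THEOREM C₆, GIVEN LEVEL `3`**: level `3` for all `p ≥ 5` implies level `6` for all `p ≥ 124426` (through
THEOREMS C₄ and C₅). -/
theorem c025_six_of_three (h3 : ∀ (M : Matroid α) [M.Finite] (p : ℕ), 5 ≤ p → RLS M p 3) :
    ∀ (M : Matroid α) [M.Finite] (p : ℕ), 124426 ≤ p → RLS M p 6 :=
  c025_six_of_five (c025_five_of_three h3)

end ThmN

end PercRepro
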